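import Literature.Computability.Complexity.TableauSnapshots
import Literature.Computability.Complexity.TableauRowsProofs
import Literature.Computability.Complexity.SearchToDecision
import HarnessLib

/-!
# Snapshots of a fixed machine are polynomial time (discharge of `Tableau.snapshot_mem_P`)

`TableauSnapshots.lean` vendors, as the named fact `Tableau.snapshot_mem_P`, that for every
bundled machine `M : Turing.TM2ComputableAux Bool Bool` the *snapshot language*
`Tableau.snapshotLang M = {⟨w, ⟨t̂, ⟨Ĵ, v̂⟩⟩⟩ | block #₁Ĵ of configuration #₁t̂ of M on w is value
number #₁v̂}` (unary fields, `ucount` = number of `1`s) is in `P` — the clocked simulation of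
Arora–Barak 2009, Thm. 1.9 with §1.4.1 ("a variant of the universal TM that gets a number `T` as
an extra input … by adding a time counter"), for ONE fixed machine, reading off a block of the
configuration reached. This file PROVES it (`Tableau.snapshot_mem_P_holds`) by assembling the
tree's toolkit; no Turing machine is written here:

* **typed clocked iteration** (`ClockedFP.iterate_typed_mem_FP`): if `F : α → α` is
  polynomial-time w.r.t. a bit encoding `ea` (`PolyTimeComputable ea ea F`) with polynomially
  bounded iterates, and `clk, pay ∈ FP` with `pay z = ea (a z)`, then
  `z ↦ ea (F^[#₁ (clk z)] (a z)) ∈ FP` — the loop machine `PolyTimeComputable.iterate_of_poly`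
  (`IterateFPPoly.lean`) fed through the recoder `stageIt` (`IterateFP.lean`) with the word
  `0 1ⁿ 0 (pay z)`; working with the TYPED map (configurations, `ea = CfgCodes.codeCfg`) the size
  bound is only needed on genuine codes, where it is the linear growth of stacks along a run
  (`CfgCodes.length_codeCfg_iterate_stepTotal_le`);
* **the pipeline** `snapFn M = read ∘ pop^J ∘ push ∘ step^t ∘ init`: the initial code of the
  standard machine `sc M` on `w` (`Tableau.initFn`, `TableauRowsProofs.lean`), `t` total steps
  (`CfgCodes.stepFn`, `TM2Std.iterate_stepTotal_initList_stkCode`), one pass pushing the unused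
  symbol `0` on every stack (`CfgCodes.pushT`, so that no case distinction on `J = 0` and no
  `J - 1` is needed), `J` popping passes (`Tableau.popFn`), and the header reader `rdV`
  (`CfgCodes.firstFn`): if the top of the input stack is the dummy the block is the control
  block `0`, else the tops are the cells at depth `J - 1`, decoded along `TM2Std.decOpt`
  (symbols of a run are allowed, `TM2Std.allowed_of_getElem?_iterate`); the reader outputs the
  unary numeral `1^{#value}` (`valWord`, numbering `Tableau.valEquiv`);
* **the class**: `snapshotLang M = {z | snapFn M z = 1^{#₁ v̂}}` is an equality test of two `FP`
  functions, in `P` by `setOf_apply_eq_apply_mem_P` (`StringEquality.lean`).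

Design note: `TableauRowsProofs.lean` (the row language in `EXP`, binary indices) drives its loops
at the level of bit strings with a length guard (`Brick.guardLoop`); here the indices are unary,
so the loop machine is applied to the typed step/pop maps directly and no guard is needed. The
definitions `sc`, `initFn`, `popFn`, `cfgStd` of that file are reused, not restated.

## References

* S. Arora, B. Barak, *Computational Complexity: A Modern Approach*, CUP 2009, Thm. 1.9 and
  §1.4.1, "Universal TM with time bound" (pp. 20–21); proof of Thm. 6.20 (reading a snapshot).
  doi:10.1017/cbo9780511804090 [AroraBarakCC2009]
* M. Sipser, *Introduction to the Theory of Computation*, 3rd ed., Cengage 2012, proof of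
  Thm. 9.30 (rows and cells of a tableau). [Sipser2012]
-/

noncomputable section

namespace Literature.Computability.Complexity

open Turing _root_.Computability Polynomial

/-! ### Clocked iteration of a typed polynomial-time map on `FP` data -/

namespace ClockedFP

/-- `onesOf u = 1^{#₁ u}`: the unary numeral of the number of `1`s of a word (the padding-tolerant
reading `ucount` of a unary field). [folklore] -/
def onesOf (u : List Bool) : List Bool := [] ++ u.flatMap fun b => cond b [true] []

/-- `onesOf u = 1^{#₁ u}`. [folklore] -/
theorem onesOf_apply (u : List Bool) : onesOf u = List.replicate (u.count true) true := by
  rw [onesOf, List.nil_append]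
  induction u with
  | nil => rfl
  | cons b u ih => cases b <;> simp [ih, List.replicate_succ]

/-- `onesOf ∈ FP` (a one-state transducer, `CfgCodes.preMap_mem_FP`). [folklore] -/
theorem onesOf_mem_FP : onesOf ∈ FP := CfgCodes.preMap_mem_FP [] _

/-- The clock-and-payload word `0 1ⁿ 0 payload` (`hdr 0 n payload` of `UnaryArithMachines.lean`)
assembled from a clock field (its number of `1`s is `n`) and a payload, both computed from the
input. [folklore] -/
def clockWord (clk pay : List Bool → List Bool) : List Bool → List Bool :=
  appendFn ∘ fanoutFn (List.cons false ∘ onesOf ∘ clk) (List.cons false ∘ pay)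

/-- `clockWord clk pay z = hdr 0 (#₁ (clk z)) (pay z)`. [folklore] -/
theorem clockWord_apply (clk pay : List Bool → List Bool) (z : List Bool) :
    clockWord clk pay z = hdr 0 ((clk z).count true) (pay z) := by
  simp [clockWord, onesOf_apply, hdr]

/-- `clockWord clk pay ∈ FP` for `clk, pay ∈ FP` (`cons_mem_FP`, `fanoutFn_mem_FP`,
`appendFn_mem_FP`). [folklore] -/
theorem clockWord_mem_FP {clk pay : List Bool → List Bool} (hclk : clk ∈ FP) (hpay : pay ∈ FP) :
    clockWord clk pay ∈ FP :=
  comp_mem_FP appendFn_mem_FP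
    (fanoutFn_mem_FP (comp_mem_FP (cons_mem_FP false) (comp_mem_FP onesOf_mem_FP hclk))
      (comp_mem_FP (cons_mem_FP false) hpay))

/-- **Clocked iteration of a typed polynomial-time map on `FP` data.** Let `F : α → α` be
polynomial-time w.r.t. a bit encoding `ea` with polynomially bounded iterates
(`|ea (F^[n] a)| ≤ B (|ea a| + n)`). If `clk, pay ∈ FP` and `pay z` is always the code of some
`a z : α`, then `z ↦ ea (F^[#₁ (clk z)] (a z))` is in `FP`: lay out `0 1ⁿ 0 (pay z)`, recode it
(`stageIt`) and run the loop machine (`PolyTimeComputable.iterate_of_poly`) — the time-counter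
device of the clocked universal machine. [cite: AroraBarakCC2009, §1.4.1] -/
theorem iterate_typed_mem_FP {α : Type} {ea : α → List Bool} {F : α → α}
    (hF : PolyTimeComputable ea ea F) (B : Polynomial ℕ)
    (hB : ∀ a n, (ea (F^[n] a)).length ≤ B.eval ((ea a).length + n))
    {clk pay : List Bool → List Bool} (hclk : clk ∈ FP) (hpay : pay ∈ FP) (a : List Bool → α)
    (ha : ∀ z, pay z = ea (a z)) :
    (fun z => ea (F^[(clk z).count true] (a z))) ∈ FP := by
  obtain ⟨p, Mx, hM⟩ :=
    PolyTimeComputable.comp_holds polyTimeComputable_stageIt (clockWord_mem_FP hclk hpay)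
  have h2 : PolyTimeComputable (id : List Bool → List Bool)
      (fun q : α × ℕ => List.replicate q.2 none ++ (ea q.1).map some)
      (fun z => (a z, (clk z).count true)) := by
    refine ⟨p, Mx, fun z => ?_⟩
    have h := hM z
    simp only [Function.comp_apply, clockWord_apply, stageIt_hdr, id] at h
    rw [ha z] at h
    exact h
  have h3 := PolyTimeComputable.comp_holds (PolyTimeComputable.iterate_of_poly B hB hF) h2
  exact h3

/-- A typed map is polynomial-time w.r.t. `ea` as soon as an `FP` string function realises it on
codes. [folklore] -/
theorem polyTimeComputable_of_mem_FP {α : Type} {ea : α → List Bool} {F : α → α}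
    {f : List Bool → List Bool} (hf : f ∈ FP) (h : ∀ a, f (ea a) = ea (F a)) :
    PolyTimeComputable ea ea F := by
  obtain ⟨p, Mx, hM⟩ := hf
  refine ⟨p, Mx, fun a => ?_⟩
  have := hM (ea a)
  simp only [id, h a] at this
  exact this

end ClockedFP

/-! ### Growth of configuration codes along runs and pops; the pushing pass -/

namespace CfgCodes

open TM2Std TM2Sim

variable (c : SCode)

/-- A coded block word is at least as long as the block word. [folklore] -/
theorem length_le_length_flatMap_code (as : List (Blk c)) :
    as.length ≤ (as.flatMap (code c)).length := by
  induction as with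
  | nil => simp
  | cons a as ih =>
    simp only [List.flatMap_cons, List.length_cons, List.length_append, code, List.length_replicate]
    omega

/-- The total stack length of a configuration is at most `|codeCfg x| + nK · D`. [folklore] -/
theorem sum_length_stk_le (x : c.tm.Cfg) :
    ∑ k, (x.stk k).length ≤ (codeCfg c x).length + c.nK * D c := by
  have h1 : (encCfg c x).length ≤ (codeCfg c x).length := length_le_length_flatMap_code c _
  rw [length_encCfg] at h1
  have h2 : ∑ k, (x.stk k).length ≤ ∑ k, ((x.stk k).drop (D c)).length + c.nK * D c := by
    have hk : ∀ k : c.tm.K, (x.stk k).length ≤ ((x.stk k).drop (D c)).length + D c := fun k => by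
      rw [List.length_drop]; omega
    calc ∑ k, (x.stk k).length ≤ ∑ k, (((x.stk k).drop (D c)).length + D c) :=
          Finset.sum_le_sum fun k _ => hk k
      _ = _ := by
          rw [Finset.sum_add_distrib, Finset.sum_const, Finset.card_univ, Fintype.card_fin, smul_eq_mul]
  omega

/-- The size polynomial of a run: `w · ((1 + nK + nK D) + X + nK·depth · X)`. [folklore] -/
def runPoly : Polynomial ℕ :=
  C (w c) * (C (1 + c.nK + c.nK * D c) + X + C (c.nK * depth c.tm) * X)

/-- **Codes along a total run grow linearly** (every configuration, every number of steps):
`|codeCfg (stepTotal^[n] x)| ≤ runPoly (|codeCfg x| + n)`. [folklore] -/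
theorem length_codeCfg_iterate_stepTotal_le (x : c.tm.Cfg) (n : ℕ) :
    (codeCfg c ((stepTotal c.tm)^[n] x)).length ≤ (runPoly c).eval ((codeCfg c x).length + n) := by
  have h1 := length_codeCfg_le c ((stepTotal c.tm)^[n] x)
  have h2 : ∑ k, (((stepTotal c.tm)^[n] x).stk k).length ≤ ∑ k, ((x.stk k).length + depth c.tm * n) :=
    Finset.sum_le_sum fun k _ => length_iterate_stepTotal_le c.tm x k n
  rw [Finset.sum_add_distrib, Finset.sum_const, Finset.card_univ, Fintype.card_fin, smul_eq_mul] at h2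
  have h3 := sum_length_stk_le c x
  have h4 : c.nK * (depth c.tm * n) ≤ c.nK * depth c.tm * ((codeCfg c x).length + n) := by
    rw [Nat.mul_assoc]
    exact Nat.mul_le_mul_left _ (Nat.mul_le_mul_left _ (Nat.le_add_left _ _))
  simp only [runPoly, eval_mul, eval_add, eval_C, eval_X]
  refine h1.trans (Nat.mul_le_mul_left _ ?_)
  omega

/-- Iterated popping drops symbols from every stack. [folklore] -/
theorem iterate_popΦ (x : c.tm.Cfg) (n : ℕ) :
    (popΦ c)^[n] x = ⟨x.l, x.var, fun k => (x.stk k).drop n⟩ := by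
  induction n generalizing x with
  | zero => obtain ⟨l, v, S⟩ := x; simp
  | succ n ih =>
    rw [Function.iterate_succ_apply, ih]
    simp only [popΦ, List.drop_drop]
    congr 2
    funext k
    rw [Nat.add_comm 1 n]

/-- The size polynomial of popping: `w · (X + (1 + nK + nK D))`. [folklore] -/
def popPoly : Polynomial ℕ := C (w c) * (X + C (1 + c.nK + c.nK * D c))

/-- **Codes shrink under popping** (up to the header): `|codeCfg (popΦ^[n] x)| ≤ popPoly (|codeCfg x| + n)`.
[folklore] -/
theorem length_codeCfg_iterate_popΦ_le (x : c.tm.Cfg) (n : ℕ) :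
    (codeCfg c ((popΦ c)^[n] x)).length ≤ (popPoly c).eval ((codeCfg c x).length + n) := by
  rw [iterate_popΦ]
  set y : c.tm.Cfg := ⟨x.l, x.var, fun k => (x.stk k).drop n⟩ with hy
  have h1 := length_codeCfg_le c y
  have h2 : ∑ k, (y.stk k).length ≤ ∑ k, (x.stk k).length :=
    Finset.sum_le_sum fun k _ => by simp [hy]
  have h3 := sum_length_stk_le c x
  simp only [popPoly, eval_mul, eval_add, eval_C, eval_X]
  refine h1.trans (Nat.mul_le_mul_left _ ?_)
  omega

/-- The configuration map "push the unused symbol `0` on every stack" (so that after `J` pops the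
tops are the cells at depth `J - 1`, and for `J = 0` the dummy `0` signals the control block).
[folklore] -/
def pushΦ (x : c.tm.Cfg) : c.tm.Cfg := ⟨x.l, x.var, fun k => (0 : Sym c) :: x.stk k⟩

/-- `pushΦ` lengthens truncated stacks to at most `2D`. [folklore] -/
theorem length_pushΦ_stk_le (x : c.tm.Cfg) (hx : ∀ k, (x.stk k).length ≤ D c) (k : Fin c.nK) :
    ((pushΦ c x).stk k).length ≤ 2 * D c := by
  have h := hx k
  have h1 := one_le_D c
  simp only [pushΦ, List.length_cons]
  omega

/-- **The pushing transducer**: `passT` of `pushΦ`. [cite: AroraBarakCC2009, §1.4] -/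
def pushT : FST (St c) (Blk c) (Blk c) := passT c (pushΦ c)

/-- **The pushing transducer pushes `0` on every stack of a code.** [folklore] -/
theorem pushT_eval_encCfg (x : c.tm.Cfg) :
    (pushT c).eval (encCfg c x) = encCfg c (pushΦ c x) := by
  have hpre : encCfg c x = preEnc c x.l x.var (fun k => (x.stk k).take (D c)) fun k => (x.stk k).drop (D c) := by
    rw [encCfg, preEnc, preEnc, toWin_take]
  rw [pushT, hpre, passT_eval_preEnc c _ (length_pushΦ_stk_le c) _ _ _ _ (fun k => List.length_take_le _ _)]
  simp only [pushΦ]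
  congr 2
  funext k
  rw [List.cons_append, List.take_append_drop]

/-- **The pushing function on bit strings.** [folklore] -/
def pushFn : List Bool → List Bool := bitsFn c (pushT c)

/-- `pushFn ∈ FP`. [folklore] -/
theorem pushFn_mem_FP : pushFn c ∈ FP := bitsFn_mem_FP c _

/-- `pushFn (codeCfg x) = codeCfg (pushΦ x)`. [folklore] -/
theorem pushFn_codeCfg (x : c.tm.Cfg) : pushFn c (codeCfg c x) = codeCfg c (pushΦ c x) := by
  rw [pushFn, codeCfg, bitsFn_flatMap_code, pushT_eval_encCfg, codeCfg]

/-- One step of the machine is polynomial-time on coded configurations (typed form). [folklore] -/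
theorem polyTimeComputable_stepTotal : PolyTimeComputable (codeCfg c) (codeCfg c) (stepTotal c.tm) :=
  ClockedFP.polyTimeComputable_of_mem_FP (stepFn_mem_FP c) (stepFn_codeCfg c)

end CfgCodes

/-! ### The snapshot decider -/

namespace Tableau

open TM2Std TM2Sim CfgCodes FinTM2Sim Brick ClockedFP

variable (M : TM2ComputableAux Bool Bool)

/-- The input word `w` of a query `z = ⟨w, ⟨t̂, ⟨Ĵ, v̂⟩⟩⟩`. [folklore] -/
def qW (z : List Bool) : List Bool := (boolUnpair z).1

/-- The step count `t = #₁ t̂` of a query. [folklore] -/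
def qT (z : List Bool) : ℕ := ucount (boolUnpair (boolUnpair z).2).1

/-- The block index `J = #₁ Ĵ` of a query. [folklore] -/
def qJ (z : List Bool) : ℕ := ucount (boolUnpair (boolUnpair (boolUnpair z).2).2).1

/-- The value number `v = #₁ v̂` of a query. [folklore] -/
def qV (z : List Bool) : ℕ := ucount (boolUnpair (boolUnpair (boolUnpair z).2).2).2

/-- Popping is polynomial-time on coded configurations (typed form of `Tableau.popFn`). [folklore] -/
theorem polyTimeComputable_popΦ : PolyTimeComputable (codeCfg (sc M)) (codeCfg (sc M)) (popΦ (sc M)) :=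
  ClockedFP.polyTimeComputable_of_mem_FP (popFn_mem_FP M) (popFn_codeCfg M)

/-- The bit code of configuration `t` of the standard machine on the coded input (`t`, `w` read
off the query; `Tableau.cfgStd`). [folklore] -/
def runCode (z : List Bool) : List Bool := codeCfg (sc M) (cfgStd M (qW z) (qT z))

/-- **The clocked run is in `FP`**: the clocked iteration of the one-step function
(`CfgCodes.stepFn`) from the initial code (`Tableau.initFn`), driven by the unary field `t̂` — the
time-counter simulation of Arora–Barak for the fixed machine `M`. [cite: AroraBarakCC2009, Thm. 1.9 and §1.4.1] -/
theorem runCode_mem_FP : runCode M ∈ FP :=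
  ClockedFP.iterate_typed_mem_FP (polyTimeComputable_stepTotal (sc M)) (runPoly (sc M))
    (length_codeCfg_iterate_stepTotal_le (sc M)) (nthF_mem_FP 1)
    (comp_mem_FP (initFn_mem_FP M) fstF_mem_FP)
    (fun z => initList (sc M).tm ((qW z).map (ι M))) fun z => initFn_apply M (fstF z)

/-- Configuration `t` with the dummy `0` pushed on every stack and then popped `J` times: its
stack tops are the cells at depth `J - 1` of configuration `t` (the dummy itself if `J = 0`).
[cite: AroraBarakCC2009, Thm. 6.20 (proof: reading a snapshot)] -/
def popCfg (z : List Bool) : (sc M).tm.Cfg := (popΦ (sc M))^[qJ z] (pushΦ (sc M) (cfgStd M (qW z) (qT z)))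

/-- `popCfg` explicitly, in terms of the coded run of `M` (`cfgOf`, `TableauSnapshots.lean`). [folklore] -/
theorem popCfg_eq (z : List Bool) :
    popCfg M z = ⟨(trCfg M.tm (cfgOf M (qW z) (qT z))).l, (trCfg M.tm (cfgOf M (qW z) (qT z))).var,
      fun k => ((0 : Sym (sc M)) :: (trCfg M.tm (cfgOf M (qW z) (qT z))).stk k).drop (qJ z)⟩ := by
  rw [popCfg, iterate_popΦ, cfgStd_eq]
  rfl

/-- The bit code of the pushed-and-popped configuration. [folklore] -/
def popCode (z : List Bool) : List Bool := codeCfg (sc M) (popCfg M z)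

/-- **The popped code is in `FP`** (one pushing pass, then the clocked iteration of the popping
pass driven by the unary field `Ĵ`). [cite: AroraBarakCC2009, §1.4.1] -/
theorem popCode_mem_FP : popCode M ∈ FP :=
  ClockedFP.iterate_typed_mem_FP (polyTimeComputable_popΦ M) (popPoly (sc M))
    (length_codeCfg_iterate_popΦ_le (sc M)) (nthF_mem_FP 2)
    (comp_mem_FP (pushFn_mem_FP (sc M)) (runCode_mem_FP M))
    (fun z => pushΦ (sc M) (cfgStd M (qW z) (qT z))) fun _ => pushFn_codeCfg (sc M) _

/-- The unary numeral `1^{#V}` of the number of a block value (`valEquiv`). [folklore] -/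
def valWord (V : Val M.tm) : List Bool := List.replicate (valEquiv M V) true

/-- **The header reader**: on the header of the pushed-and-popped configuration, if the top of the
(coded) input stack is the dummy `0` (`J = 0`) output the numeral of the control block
`((label, state), empty cell)`, decoding label and state along `eΛ`, `eσ`; otherwise output the
numeral of `(default, cell)`, the cell decoding the tops along `TM2Std.decOpt` and
`FinTM2Sim.toSym` (as `Tableau.gCtrl`, `Tableau.gCell`, with unary output). Non-header blocks read
as `[]`. [cite: AroraBarakCC2009, Thm. 6.20 (proof: reading a snapshot)] -/
def rdV : Blk (sc M) → List Bool
  | Blk.hdr l v win =>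
    if win (eK M.tm M.tm.k₀) ⟨0, one_le_D (sc M)⟩ = some 0 then
      valWord M ((l.map (eΛ M.tm).symm, (eσ M.tm).symm v), noneCell M.tm)
    else
      valWord M (default, fun k =>
        (decOpt M.tm k (win (eK M.tm k) ⟨0, one_le_D (sc M)⟩)).bind (toSym M.tm k))
  | _ => []

/-- **The snapshot function**: read the header of the pushed-and-popped configuration `t`.
[cite: AroraBarakCC2009, Thm. 1.9 and §1.4.1] -/
def snapFn : List Bool → List Bool := firstFn (sc M) (rdV M) ∘ popCode M

/-- **The snapshot function is in `FP`.** [cite: AroraBarakCC2009, Thm. 1.9 and §1.4.1] -/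
theorem snapFn_mem_FP : snapFn M ∈ FP := comp_mem_FP (firstFn_mem_FP _ _) (popCode_mem_FP M)

/-- Codes of input-stack symbols are never the dummy `0` (input symbols are allowed). [folklore] -/
theorem map_enc_ne_some_zero (o : Option (M.tm.Γ M.tm.k₀)) :
    o.map (fun γ => TM2Std.enc M.tm ⟨M.tm.k₀, γ⟩) ≠ some 0 := by
  cases o with
  | none => simp
  | some γ =>
    simp only [Option.map_some, ne_eq, Option.some.injEq]
    unfold TM2Std.enc
    rw [dif_pos (show (⟨M.tm.k₀, γ⟩ : Σ k, M.tm.Γ k) ∈ allowed M.tm from Or.inl ⟨γ, rfl⟩)]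
    exact Fin.succ_ne_zero _

/-- **The snapshot function computes the numeral of block `J` of configuration `t` of `M` on `w`.**
[cite: AroraBarakCC2009, Thm. 1.9 and §1.4.1] -/
theorem snapFn_apply (z : List Bool) :
    snapFn M z = valWord M (absVal (cfgOf M (qW z) (qT z)) (qJ z)) := by
  rw [show snapFn M z = firstFn (sc M) (rdV M) (codeCfg (sc M) (popCfg M z)) from rfl,
    firstFn_codeCfg, popCfg_eq]
  set x := cfgOf M (qW z) (qT z) with hx
  cases hJ : qJ z with
  | zero =>
    have hwin : toWin (sc M) (fun k' => (((0 : Sym (sc M)) :: (trCfg M.tm x).stk k').drop 0))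
        (eK M.tm M.tm.k₀) ⟨0, one_le_D (sc M)⟩ = some 0 := rfl
    simp only [rdV, hwin, ↓reduceIte]
    rw [absVal_zero, trCfg_l, trCfg_var, Option.map_map, Equiv.symm_apply_apply,
      Equiv.symm_comp_self, Option.map_id]
    rfl
  | succ j =>
    have hwin : ∀ k, toWin (sc M) (fun k' => (((0 : Sym (sc M)) :: (trCfg M.tm x).stk k').drop (j + 1)))
        (eK M.tm k) ⟨0, one_le_D (sc M)⟩ = ((x.stk k)[j]?).map fun γ => TM2Std.enc M.tm ⟨k, γ⟩ := by
      intro k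
      rw [toWin_zero]
      show (List.drop (j + 1) ((0 : Sym (sc M)) :: (trCfg M.tm x).stk (eK M.tm k)))[0]? = _
      rw [List.drop_succ_cons, List.getElem?_drop, ← getElem?_trCfg_stk M.tm x k j]
      rfl
    have hdec : ∀ k, decOpt M.tm k (((x.stk k)[j]?).map fun γ => TM2Std.enc M.tm ⟨k, γ⟩) = (x.stk k)[j]? := by
      intro k
      cases h : (x.stk k)[j]? with
      | none => rfl
      | some γ =>
        rw [Option.map_some]
        refine decOpt_enc M.tm ?_
        rw [hx] at h
        exact allowed_of_getElem?_iterate M.tm _ _ k h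
    have hne : toWin (sc M) (fun k' => (((0 : Sym (sc M)) :: (trCfg M.tm x).stk k').drop (j + 1)))
        (eK M.tm M.tm.k₀) ⟨0, one_le_D (sc M)⟩ ≠ some 0 := by
      rw [hwin]; exact map_enc_ne_some_zero M _
    simp only [rdV, hne, ↓reduceIte, absVal_succ]
    congr 1
    refine Prod.ext rfl (funext fun k => ?_)
    change (decOpt M.tm k _).bind (toSym M.tm k) = ((x.stk k)[j]?).bind (toSym M.tm k)
    rw [hwin k, hdec k]

/-! ### The snapshot language is polynomial time -/

/-- **The snapshot language as an equality test of two `FP` functions**: `z` is a snapshot fact iff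
the numeral of block `J` of configuration `t` equals the numeral `1ᵛ` of the value field.
[cite: AroraBarakCC2009, Thm. 1.9 and §1.4.1] -/
theorem snapshotLang_eq : snapshotLang M = {z | snapFn M z = onesOf (sndPow 2 z)} := by
  ext z
  rw [mem_snapshotLang_iff]
  change (∃ h : qV z < Nat.card (Val M.tm),
      absVal (cfgOf M (qW z) (qT z)) (qJ z) = (valEquiv M).symm ⟨_, h⟩) ↔
    snapFn M z = onesOf (sndPow 2 z)
  rw [snapFn_apply, onesOf_apply]
  change _ ↔ valWord M (absVal (cfgOf M (qW z) (qT z)) (qJ z)) = List.replicate (qV z) true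
  constructor
  · rintro ⟨h, he⟩
    rw [valWord, he, Equiv.apply_symm_apply]
  · intro he
    have hl : ((valEquiv M (absVal (cfgOf M (qW z) (qT z)) (qJ z))) : ℕ) = qV z := by
      simpa [valWord] using congrArg List.length he
    refine ⟨hl ▸ (valEquiv M (absVal (cfgOf M (qW z) (qT z)) (qJ z))).isLt, ?_⟩
    rw [Equiv.eq_symm_apply]
    exact Fin.ext hl

/-- **Snapshots of a fixed machine are polynomial time** — discharge of the named fact
`snapshot_mem_P`: for every bundled machine `M : TM2ComputableAux Bool Bool`, `snapshotLang M ∈ P`.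
On `z = ⟨w, ⟨1ᵗ0*, ⟨1ᴶ0*, 1ᵛ0*⟩⟩⟩`: code the initial configuration of the standard machine of `M`
on `w` (`initFn`), run the one-step function `t` times under a unary clock (`runCode`: the
time-counter simulation of Arora–Barak, Thm. 1.9 with §1.4.1 "Universal TM with time bound", for
one fixed machine, so that no interpreter is needed), push a dummy and pop `J` times (`popCode`),
read block `J` off the header (`snapFn`) and compare with `1ᵛ` (`setOf_apply_eq_apply_mem_P`).
[cite: AroraBarakCC2009, Thm. 1.9 and §1.4.1] -/
theorem snapshot_mem_P_holds : snapshot_mem_P := fun M => by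
  rw [snapshotLang_eq]
  have hg : (onesOf ∘ sndPow 2) ∈ FP := comp_mem_FP onesOf_mem_FP (sndPow_mem_FP 2)
  exact setOf_apply_eq_apply_mem_P (f := snapFn M) (g := onesOf ∘ sndPow 2) (snapFn_mem_FP M) hg

end Tableau

end Literature.Computability.Complexity

end
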